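import Mathlib
import HarnessLib
import Summits.HubbardSuperconductivity.HubbardSuperconductivity.Theorems.KLProgrammeKLRegimeEngineSectorisedKernelTransfer
import Summits.HubbardSuperconductivity.HubbardSuperconductivity.Theorems.KLProgrammeKLRegimeEngineKernelFromParentSup
import Summits.HubbardSuperconductivity.HubbardSuperconductivity.Theorems.KLProgrammeH10TwoPointLimitFrameSectorOverlap
import Summits.HubbardSuperconductivity.HubbardSuperconductivity.Theorems.KLProgrammeKLRegimeEngineIsoLineAssembly

/-!
# Route `KLProgramme` — ENGINE item stmt-HubbardSuperconductivity-20437, class #6 / (E5-F)ₙ producer, route (M): L¹ TRANSPORT of the iso fixed-tuple line to FINER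
# resolutions (`m ≥ n′ + 1` from `n′`, cost `9⁴·klIsoT⁴`) and the M3 assembly with the moment budget AT THE KERNEL'S OWN RESOLUTION ONLY (ALPHA0 §2.3, mass half)

Cell gate-hubbard-kl, seat hubbard-kl-k3c2-p2 (g12; owner-designate of M1 + M3 of route (M), pen (R59az)).  Instance of the generic transfer bound
`fixedTupleL1_le_of_plateau_transfer` (…EngineSectorisedKernelTransfer) on the pair (iso `m`, iso `n′`), `n′ + 1 ≤ m` (the coarse iso family sums to `1` below `Λ_{n′+1} ≥ Λ_m`,
`sum_klIsoFamily_eq_one_of_le`):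

* `card_isoParents_le` (`≤ 9^{d+1}` coarse iso sector strings overlap a fine one leg by leg, `card_coarse_overlap_le` on the angular indices `2n′ ≤ 2m`);
* `transferSums_klIso_le` (column and row sums of `E(klIsoFamily … m)·S(1)` are `≤ klIsoT/ε` under the stub binders: `isoTorusBoundAt_klIsoT` + `charSum_klIso_single_le_of_padded`
  + `overlapKernel_sums_le_of_charSum_le` with the trivial coarse family);
* **`fixedTupleL1_klIsoKernelAt_le_of_coarser_klEng`** — under the stub binders, `n′ + 1 ≤ m`, any kernel scale `n`, any spin/charge strings: if every iso tuple of resolution `n′`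
  with those spins/charges has `fixedTupleL1 β 3 (klIsoKernelAt … K n n′) ≤ S` at every pin, then `fixedTupleL1 β 3 (klIsoKernelAt … K n m) Ω x₁ ≤ 9⁴·klIsoT⁴·S`;
* **`fixedTupleL1_klIsoKernelAt_le_valueMomentsAtScale_klEng`** — the M3 assembly with the moment budget asked AT RESOLUTION `n` ONLY: `∃ A′ ≥ 1` absolute
  (`A′ = A·(1 + 9⁴·klIsoT⁴)`, `A` of `fixedTupleL1_klIsoKernelAt_le_valueMoments_klEng`) with `fixedTupleL1 β 3 (klIsoKernelAt … K n m) Ω x₁ ≤ A′·(B + X)` for EVERY `m ≥ n ≥ 1`,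
  every `Ω`, `x₁` (`m = n` by the assembly, `m ≥ n + 1` by the transport).

So M2 ((E4-iso)ₙ, W3) is needed at the kernel's own resolution only, as in the (α-0) memo §2.3, and the moment half of §2.3 (moments at `m > n`) is not needed on route (M).
Everything is proved; no definitions; nothing about the model is asserted.  References: BGM 2006 §2.7 (2.70)–(2.71a), §2.8 (2.82)–(2.83) [cite: BenfattoGiulianiMastropietro2006].
-/

noncomputable section

namespace Summit.HubbardSuperconductivity.HubbardSuperconductivity.Theorems.EngineV8

set_option linter.dupNamespace false -- summit = problem name (single-conjunct summit), D-0017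

open Classical
open Real Finset Complex Literature.MathematicalPhysics.QuantumLattice Literature.Probability.LatticeModels GrassmannAlgebra
open Summit.HubbardSuperconductivity.HubbardSuperconductivity.Theorems.KLProgrammeLegKernels
open Summit.HubbardSuperconductivity.HubbardSuperconductivity.Theorems.KLRegimeSplit
open Summit.HubbardSuperconductivity.HubbardSuperconductivity.Theorems.TorusFourierL2
open Summit.HubbardSuperconductivity.HubbardSuperconductivity.Theorems.PerturbedFermiCurve (support_klIsoFamily card_coarse_overlap_le)
open scoped ComplexConjugate

variable {L M : ℕ} [NeZero L] [NeZero M]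

/-! ## §2 Iso ← iso: parents, transfer sums, and the transport under the stub binders -/

section Iso

omit [NeZero M] in
/-- **Parents count, iso ← iso**: a fine iso sector string of resolution `m` overlaps leg by leg (common support point) at most `9^{d+1}` coarse iso sector strings of
resolution `n′ ≤ m` (`card_coarse_overlap_le` on the angular indices `2n′ ≤ 2m`, leg by leg). -/
theorem card_isoParents_le (β μ : ℝ) (K : TrigPolyC4v) {n' m : ℕ} (hnm : n' ≤ m) {d : ℕ} (ω : Fin (d + 1) → Fin (sectorCount (2 * m))) :
    ((univ : Finset (Fin (d + 1) → Fin (sectorCount (2 * n')))).filter fun σ => ∀ i, ∃ k : FreqMomentum L M,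
        klIsoFamily L M β μ K klE0 m (ω i) k ≠ 0 ∧ klIsoFamily L M β μ K klE0 n' (σ i) k ≠ 0).card ≤ 9 ^ (d + 1) := by
  have he : (0 : ℝ) < klE0 := by norm_num [klE0]
  set C : Fin (d + 1) → Finset (Fin (sectorCount (2 * n'))) := fun i => (univ : Finset (Fin (sectorCount (2 * n')))).filter fun w =>
    ∃ θ : ℝ, sectorWeightCirc (2 * m) (((ω i) : ℕ) : ℤ) θ ≠ 0 ∧ sectorWeightCirc (2 * n') ((w : ℕ) : ℤ) θ ≠ 0 with hC
  have hCcard : ∀ i, (C i).card ≤ 9 := fun i => card_coarse_overlap_le (Nat.mul_le_mul_left 2 hnm) (ω i)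
  have hsub : ((univ : Finset (Fin (d + 1) → Fin (sectorCount (2 * n')))).filter fun σ => ∀ i, ∃ k : FreqMomentum L M,
        klIsoFamily L M β μ K klE0 m (ω i) k ≠ 0 ∧ klIsoFamily L M β μ K klE0 n' (σ i) k ≠ 0) ⊆ Fintype.piFinset C := by
    intro σ hσ
    rw [mem_filter] at hσ
    refine Fintype.mem_piFinset.2 fun i => ?_
    obtain ⟨k, h1, h2⟩ := hσ.2 i
    rw [hC, mem_filter]
    exact ⟨mem_univ _, momentumAngle L k.2, (support_klIsoFamily L M he β μ K m (ω i) k h1).2.2, (support_klIsoFamily L M he β μ K n' (σ i) k h2).2.2⟩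
  refine (card_le_card hsub).trans ?_
  rw [Fintype.card_piFinset]
  calc ∏ i, (C i).card ≤ ∏ _i : Fin (d + 1), 9 := prod_le_prod' fun i _ => hCcard i
    _ = 9 ^ (d + 1) := by rw [prod_const, card_univ, Fintype.card_fin]

/-- **The transfer sums of the iso family under the stub binders**: the column and row sums of `E(klIsoFamily … m)·S(1)` (labels matched) are `≤ klIsoT/ε`
(`isoTorusBoundAt_klIsoT`, `charSum_klIso_single_le_of_padded`, `overlapKernel_sums_le_of_charSum_le` with the trivial coarse family). -/
theorem transferSums_klIso_le (P : SplitConsts) (R : RenConsts) (c : ℝ) (hP : P.WF) (hR2 : R.WF2) (hc : 0 < c) (hc3 : c ≤ klEngC₃3 P R)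
    {μ : ℝ} (hμ : μ ∈ klWindowC) {U : ℝ} (hU : 0 < U) (hU3 : U ≤ klEngU₀3 P R c) {β : ℝ} (hβmin : klBetaMin ≤ β) (hβc : β ≤ Real.exp (c / U ^ 2))
    {K : TrigPolyC4v} (hK : FrameOK R U (nScales β) μ K) (hL3 : klEngL₃ β U ≤ L) (hM3 : klEngM₃ β U L ≤ M) (m : ℕ)
    (ω : Fin (sectorCount (2 * m))) (s c' : Fin 2) :
    (∀ y : SpaceTimeIdx L M, ∑ x : SpaceTimeIdx L M,
      ‖(sectorAnalysisMatrix L M β (klIsoFamily L M β μ K klE0 m) * sectorSubMatrix L M β (trivialMultiplier L M))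
          (x, ((ω, s), c')) (y, (((0 : Fin 1), s), c'))‖ ≤ klIsoT / imagTimeWeight β M) ∧
    (∀ x : SpaceTimeIdx L M, ∑ y : SpaceTimeIdx L M,
      ‖(sectorAnalysisMatrix L M β (klIsoFamily L M β μ K klE0 m) * sectorSubMatrix L M β (trivialMultiplier L M))
          (x, ((ω, s), c')) (y, (((0 : Fin 1), s), c'))‖ ≤ klIsoT / imagTimeWeight β M) := by
  have hβ : 0 < β := KLRegimeSplit.pos_of_klBetaMin_le hβmin
  have hMr : (0 : ℝ) < M := Nat.cast_pos.2 (Nat.pos_of_ne_zero (NeZero.ne M))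
  -- the iso single character sum
  have hiso : ∀ σ : Fin (sectorCount (2 * m)), ∑ z : TorusSite 1 (2 * M) × TorusSite 2 L,
      ‖∑ q : TorusSite 1 (2 * M) × TorusSite 2 L, (torusChar q.1 z.1 * torusChar q.2 z.2) •
        klIsoFamily L M β μ K klE0 m σ (⟨(q.1 0).val, ZMod.val_lt (q.1 0)⟩, q.2)‖ ≤ 2 * M * (L : ℝ) ^ 2 * klIsoT := by
    intro σ
    have h4 := (TorusFourierL2.isoTorusBoundAt_klIsoT : IsoTorusBoundAt klIsoT) P R c hP hR2 hc hc3 μ hμ U hU hU3 β hβmin hβc K hK L M hL3 hM3 m σ 0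
    simp only [if_true] at h4
    exact charSum_klIso_single_le_of_padded hβ μ K klE0 m σ h4
  have hT : ∀ (σ : Fin (sectorCount (2 * m))) (w : Fin 1), ∑ z : TorusSite 1 (2 * M) × TorusSite 2 L,
      ‖∑ q : TorusSite 1 (2 * M) × TorusSite 2 L, (torusChar q.1 z.1 * torusChar q.2 z.2) •
        (klIsoFamily L M β μ K klE0 m σ (⟨(q.1 0).val, ZMod.val_lt (q.1 0)⟩, q.2) *
          trivialMultiplier L M w (⟨(q.1 0).val, ZMod.val_lt (q.1 0)⟩, q.2))‖ ≤ 2 * M * (L : ℝ) ^ 2 * klIsoT := by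
    intro σ w
    simp only [trivialMultiplier, mul_one]
    exact hiso σ
  have h := overlapKernel_sums_le_of_charSum_le hβ (klIsoFamily L M β μ K klE0 m) (trivialMultiplier L M) hT
  have hLr : (L : ℝ) ≠ 0 := by exact_mod_cast NeZero.ne L
  have hval : 2 * M * (L : ℝ) ^ 2 * klIsoT / (β * (L : ℝ) ^ 2) = klIsoT / imagTimeWeight β M := by
    rw [imagTimeWeight]
    field_simp
  refine ⟨fun y => ?_, fun x => ?_⟩
  · exact (h.2 ω 0 s c' y).trans (le_of_eq hval)
  · exact (h.1 ω 0 s c' x).trans (le_of_eq hval)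

/-- **L¹ TRANSPORT OF THE ISO LINE TO A FINER RESOLUTION** (stub binders; `n′ + 1 ≤ m`; any kernel scale `n`, any spin/charge strings `s, c`): if every iso tuple of
resolution `n′` with the spins/charges `(s, c)` has `fixedTupleL1 β 3 (klIsoKernelAt … K n n′) ((σ i, s i), c i) y₀ ≤ S` at every pin, then every iso tuple of resolution `m`
with the same spins/charges has `fixedTupleL1 β 3 (klIsoKernelAt … K n m) ((ω i, s i), c i) x₁ ≤ 9⁴·klIsoT⁴·S`. -/
theorem fixedTupleL1_klIsoKernelAt_le_of_coarser_klEng (P : SplitConsts) (R : RenConsts) (c : ℝ) (hP : P.WF) (hR2 : R.WF2) (hc : 0 < c)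
    (hc3 : c ≤ klEngC₃3 P R) {μ : ℝ} (hμ : μ ∈ klWindowC) {U : ℝ} (hU : 0 < U) (hU3 : U ≤ klEngU₀3 P R c) {β : ℝ} (hβmin : klBetaMin ≤ β)
    (hβc : β ≤ Real.exp (c / U ^ 2)) {K : TrigPolyC4v} (hK : FrameOK R U (nScales β) μ K) (hL3 : klEngL₃ β U ≤ L) (hM3 : klEngM₃ β U L ≤ M)
    (n : ℕ) {n' m : ℕ} (hm : n' + 1 ≤ m) (s c' : Fin 4 → Fin 2) (ω : Fin 4 → Fin (sectorCount (2 * m))) {S : ℝ} (hS0 : 0 ≤ S)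
    (hS : ∀ (σ : Fin 4 → Fin (sectorCount (2 * n'))) (y₀ : SpaceTimeIdx L M),
      fixedTupleL1 L M β 3 (klIsoKernelAt L M β U μ K n n') (fun i => ((σ i, s i), c' i)) y₀ ≤ S)
    (x₁ : SpaceTimeIdx L M) :
    fixedTupleL1 L M β 3 (klIsoKernelAt L M β U μ K n m) (fun i => ((ω i, s i), c' i)) x₁ ≤ 9 ^ 4 * klIsoT ^ 4 * S := by
  have hβ : 0 < β := KLRegimeSplit.pos_of_klBetaMin_le hβmin
  have he : (0 : ℝ) < klE0 := by norm_num [klE0]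
  have hI0 : 0 ≤ klIsoT := klIsoT_nonneg
  set F' := klIsoFamily L M β μ K klE0 m with hF'
  set F := klIsoFamily L M β μ K klE0 n' with hF
  set Ω' : Fin 4 → SectorLeg (sectorCount (2 * m)) := fun i => ((ω i, s i), c' i) with hΩ'
  -- plateau: the coarse iso family sums to `1` on the fine supports
  have hpl : ∀ (i : Fin 4) (k : FreqMomentum L M), F' (Ω' i).1.1 k ≠ 0 → ∑ w, F w k = 1 := by
    intro i k hk
    have hlt : Real.sqrt (matsubaraFreq β M k.1 ^ 2 + nambuXiCT L μ K k.2 ^ 2) < klScale klE0 m :=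
      lt_of_not_ge fun hge => hk (klIsoFamily_eq_zero_of_le he β μ K m (ω i) k hge)
    exact sum_klIsoFamily_eq_one_of_le β μ K n' k (hlt.le.trans (klScale_le_klScale he.le hm))
  -- parents
  set Par : Finset (Fin 4 → Fin (sectorCount (2 * n'))) := (univ : Finset (Fin 4 → Fin (sectorCount (2 * n')))).filter fun σ =>
    ∀ i, ∃ k : FreqMomentum L M, klIsoFamily L M β μ K klE0 m (ω i) k ≠ 0 ∧ klIsoFamily L M β μ K klE0 n' (σ i) k ≠ 0 with hPar
  have hParc : (Par.card : ℝ) ≤ 9 ^ 4 := by exact_mod_cast card_isoParents_le (L := L) (M := M) β μ K (by omega : n' ≤ m) ω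
  have hParout : ∀ σ, σ ∉ Par → ∃ i, ∀ k, F' (Ω' i).1.1 k * F (σ i) k = 0 := by
    intro σ hσ
    by_contra hcon
    push Not at hcon
    refine hσ (mem_filter.2 ⟨mem_univ _, fun i => ?_⟩)
    obtain ⟨k, hk⟩ := hcon i
    exact ⟨k, (mul_ne_zero_iff.1 hk).1, (mul_ne_zero_iff.1 hk).2⟩
  -- transfer sums
  have hsum := fun i => transferSums_klIso_le (L := L) (M := M) P R c hP hR2 hc hc3 hμ hU hU3 hβmin hβc hK hL3 hM3 m (ω i) (s i) (c' i)
  have h := fixedTupleL1_le_of_plateau_transfer hβ F' F (klEffectiveAction L M β U μ K klE0 n) Ω' hpl Par hParout hI0 hS0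
    (fun i y => (hsum i).1 y) (fun x => (hsum 0).2 x) (fun σ _ y₀ => hS σ y₀) x₁
  have hrhs : (Par.card : ℝ) * klIsoT ^ (3 + 1) * S ≤ 9 ^ 4 * klIsoT ^ 4 * S :=
    mul_le_mul_of_nonneg_right (mul_le_mul_of_nonneg_right hParc (pow_nonneg hI0 _)) hS0
  exact h.trans hrhs

end Iso

/-! ## §3 The M3 assembly with the moment budget at the kernel's OWN resolution only -/

section AtScale

/-- **THE ISO LINE AT EVERY `m ≥ n` FROM THE VALUE BOUND AND THE MOMENTS AT RESOLUTION `n`** (stub binders `P.WF`, `R.WF2`, `c ≤ klEngC₃3`, `U ≤ klEngU₀3`, `klEngL₃`,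
`klEngM₃`; any admissible frame `K`; `1 ≤ n`): `∃ A′ ≥ 1` absolute with `fixedTupleL1 β 3 (klIsoKernelAt … K n m) Ω x₁ ≤ A′·(B + X)` for EVERY `m ≥ n`, `Ω`, `x₁`, where `B` is the
`↑↓` value bound on `klBall L μ 0` and `X` the scale-weighted moment budget of the STANDARD tuples AT RESOLUTION `n` (asked only if `n ≤ n_β`):
`m = n` by `fixedTupleL1_klIsoKernelAt_le_valueMoments_klEng`, `m ≥ n + 1` by the transport `fixedTupleL1_klIsoKernelAt_le_of_coarser_klEng`. -/
theorem fixedTupleL1_klIsoKernelAt_le_valueMomentsAtScale_klEng :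
    ∃ A' : ℝ, 1 ≤ A' ∧ ∀ (P : SplitConsts) (R : RenConsts) (c : ℝ), P.WF → R.WF2 → 0 < c → c ≤ klEngC₃3 P R →
      ∀ μ ∈ klWindowC, ∀ U : ℝ, 0 < U → U ≤ klEngU₀3 P R c → ∀ β : ℝ, klBetaMin ≤ β → β ≤ Real.exp (c / U ^ 2) →
      ∀ K : TrigPolyC4v, FrameOK R U (nScales β) μ K → ∀ (L M : ℕ) [NeZero L] [NeZero M], klEngL₃ β U ≤ L → klEngM₃ β U L ≤ M →
      ∀ n : ℕ, 1 ≤ n → ∀ (B X : ℝ), 0 ≤ B → 0 ≤ X →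
        (∀ k₁ ∈ klBall L μ 0, ∀ k₂ ∈ klBall L μ 0, ∀ k₃ ∈ klBall L μ 0, ‖klQuarticValue L M β U μ K n 0 1 k₁ k₂ k₃‖ ≤ B) →
        (n ≤ nScales β → ∀ (ω : Fin 4 → Fin (sectorCount (2 * n))) (x₁ : SpaceTimeIdx L M) (j : Fin 3),
          klScale klE0 n * (imagTimeWeight β M ^ 3 * ∑ y : Fin 3 → SpaceTimeIdx L M,
            spaceTimeDist L M β x₁ (y j) *
              ‖klIsoKernelAt L M β U μ K n n (fun i => ((ω i, ![(0 : Fin 2), 0, 1, 1] i), ![(0 : Fin 2), 1, 0, 1] i)) (Matrix.vecCons x₁ y)‖) ≤ X) →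
      ∀ m : ℕ, n ≤ m → ∀ (Ω : Fin 4 → SectorLeg (sectorCount (2 * m))) (x₁ : SpaceTimeIdx L M),
        fixedTupleL1 L M β 3 (klIsoKernelAt L M β U μ K n m) Ω x₁ ≤ A' * (B + X) := by
  obtain ⟨A, hA, h⟩ := fixedTupleL1_klIsoKernelAt_le_valueMoments_klEng
  have hI0 : 0 ≤ klIsoT := klIsoT_nonneg
  refine ⟨A * (1 + 9 ^ 4 * klIsoT ^ 4), ?_, ?_⟩
  · have : (1 : ℝ) ≤ 1 + 9 ^ 4 * klIsoT ^ 4 := by have := pow_nonneg hI0 4; nlinarith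
    nlinarith
  intro P R c hP hR2 hc hc3 μ hμ U hU hU3 β hβmin hβc K hK L M _ _ hL3 hM3 n hn1 B X hB0 hX0 hB hMom m hnm Ω x₁
  have hA0 : 0 ≤ A := le_trans zero_le_one hA
  have hBX : 0 ≤ B + X := add_nonneg hB0 hX0
  -- the line at the kernel's own resolution, all patterns
  have hn : ∀ (Ω₀ : Fin 4 → SectorLeg (sectorCount (2 * n))) (y₀ : SpaceTimeIdx L M),
      fixedTupleL1 L M β 3 (klIsoKernelAt L M β U μ K n n) Ω₀ y₀ ≤ A * (B + X) :=
    fun Ω₀ y₀ => h P R c hR2 hc hc3 μ hμ U hU hU3 β hβmin hβc K hK L M hL3 hM3 n n hn1 B X hB0 hX0 hB hMom Ω₀ y₀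
  rcases Nat.eq_or_lt_of_le hnm with heq | hlt
  · subst heq
    refine (hn Ω x₁).trans ?_
    have : A * (B + X) * 1 ≤ A * (B + X) * (1 + 9 ^ 4 * klIsoT ^ 4) :=
      mul_le_mul_of_nonneg_left (by have := pow_nonneg hI0 4; nlinarith) (mul_nonneg hA0 hBX)
    linarith
  · -- transport from resolution `n` to `m ≥ n + 1`, pattern by pattern
    have hΩ : Ω = fun i => (((fun i => (Ω i).1.1) i, (fun i => (Ω i).1.2) i), (fun i => (Ω i).2) i) := by
      funext i; simp
    rw [hΩ]
    have ht := fixedTupleL1_klIsoKernelAt_le_of_coarser_klEng (L := L) (M := M) P R c hP hR2 hc hc3 hμ hU hU3 hβmin hβc hK hL3 hM3 n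
      (Nat.succ_le_of_lt hlt) (fun i => (Ω i).1.2) (fun i => (Ω i).2) (fun i => (Ω i).1.1) (mul_nonneg hA0 hBX)
      (fun σ y₀ => hn _ y₀) x₁
    have e : A * (1 + 9 ^ 4 * klIsoT ^ 4) * (B + X) = 9 ^ 4 * klIsoT ^ 4 * (A * (B + X)) + A * (B + X) := by ring
    rw [e]
    linarith [mul_nonneg hA0 hBX]

end AtScale

end Summit.HubbardSuperconductivity.HubbardSuperconductivity.Theorems.EngineV8

end
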